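import Summits.NavierStokesRegularity.NavierStokesRegularity.Theorems.FilamentSkeletonRssCoreLinearInvertibilityOddSymmetrizerBounds
import Summits.AnomalousDissipation.AnomalousDissipation.Theorems.MarginalStabilityChainStretchedVortexRowsStubLogPotentialSymmetry
import Summits.AnomalousDissipation.AnomalousDissipation.Theorems.MarginalStabilityChainStretchedVortexRowsStubCircAvgPolar
import Literature.Analysis.FluidPDE.PlanarPolarCoords

/-!
# Crux `CoreLinearInvertibility` (stmt-NavierStokesRegularity-17973), line `Sketch`:
# stub `stub_evenSymmetrizerBounds` — the forward symmetrizer on the EVEN circular-mean-free sector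

Registered stub (B1) of the skeleton `Cruxes/CoreLinearInvertibility/Lines/Sketch.lean` (even sector of
the core linear invertibility estimate, non-radial part): the twin of the landed
`stub_oddSymmetrizerBounds` (`…OddSymmetrizerBounds`) for EVEN `C²_c` vorticities `w` with ZERO
CIRCULAR MEANS, `∫_{-π}^{π} w(r cos θ, r sin θ) dθ = 0` (`r > 0`).  With `ψ = N ∗ w`
(`N = (2π)⁻¹ log|·|`) and `u = Φ(|x|) ψ` (`Φ = kerWeight = G/(2Ω)`), for `λ ∈ (0,1)` there is
`C = C(λ) ≥ 0` with:

* `u ∈ C²` is even and has zero circular means: `ψ` is even for even `w` (`y ↦ −y`), and the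
  circular means of `ψ = N ∗ w` are the potentials of the circular means of `w`, which vanish
  (rotation invariance of `N` and of Lebesgue measure, Fubini; landed as
  `logPotential_circMean_eq_zero` in `Summits.AnomalousDissipation.….StubLogPotentialSymmetry`), and
  `Φ(|·|)` is constant on circles;
* everything parity-blind is re-exported from the odd tools (`stub_oddSymmetrizerBoundsToolsC`: class of
  `w + u`, the exact identity `T_{λ,R} w = H_{λ,R}(w+u) − L_λ u`, integrability and continuity);
* `‖L_λ u‖_{X_λ} ≤ C‖w‖_{X_λ}` AND the weighted gradient bound `‖ |x| ∇u ‖_{X_λ} ≤ C ‖w‖_{X_λ}`,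
  `X_λ = L²(G_λ⁻¹dx)`: both `F = L_λ u` and `F = |x| ‖∇u‖` satisfy the pointwise majorant
  `|F| ≤ |w| + c (‖Dψ‖ + |ψ|)`, `c = 6C_Φ(1+|x|)^{N+1}e^{−|x|²/4}` (for the gradient:
  `∇u = ψ∇Φ + Φ∇ψ` and `|x| ≤ 1 + |x|`), and the weighted bound for any such measurable `F` is the
  argument of `…OddSymmetrizerBounds` verbatim (weight `m = G_λ⁻¹c²`, tools D: `∫ m ψ²`, `∫ m |∇ψ|²`
  controlled by `‖w‖²_{X_λ}`), isolated here as `evenSym_weighted_sq_integral_le`.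

References: Y. Maekawa, J. Math. Fluid Mech. 13 (2011) §2; Th. Gallay, Y. Maekawa, arXiv:1610.08384,
§2.2 and §4.1; Th. Gallay, C. E. Wayne, Comm. Math. Phys. 255 (2005) §4.1 (radial/non-radial
decomposition); folklore.
-/

set_option linter.dupNamespace false

noncomputable section

namespace Summit.NavierStokesRegularity.NavierStokesRegularity.Theorems

open MeasureTheory Filter Topology Set Function Metric WithLp
open Literature.Analysis.FluidPDE
open Summit.AnomalousDissipation.AnomalousDissipation.Theorems.MarginalStabilityChainStretchedVortexRows
open scoped InnerProductSpace Laplacian ContDiff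

/-! ### Parity and circular means of `ψ` and `u` -/

section Parity

variable {w ψ u : EuclideanSpace ℝ (Fin 2) → ℝ} (hw : ContDiff ℝ 2 w) (hwc : HasCompactSupport w)
  (hψ : ∀ x, ψ x = ∫ y, (2 * Real.pi)⁻¹ * Real.log ‖x - y‖ * w y)
  (hu : ∀ x, u x = kerWeight ‖x‖ * ψ x)

include hψ in
/-- **`ψ` is even when `w` is even** (`y ↦ −y` in the integral). [folklore] -/
theorem evenSym_psi_even (heven : ∀ x, w (-x) = w x) (x : EuclideanSpace ℝ (Fin 2)) : ψ (-x) = ψ x := by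
  rw [hψ, hψ]; exact logPotential_neg heven x

include hψ hu in
/-- **`u = Φ(|x|)ψ` is even when `w` is even.** [folklore] -/
theorem evenSym_u_even (heven : ∀ x, w (-x) = w x) (x : EuclideanSpace ℝ (Fin 2)) : u (-x) = u x := by
  rw [hu, hu, norm_neg, evenSym_psi_even hψ heven]

include hw hwc hψ in
/-- **`ψ = N ∗ w` has zero circular means when `w` has**: `∫_{-π}^{π} ψ(r cos θ, r sin θ) dθ = 0`
(`r > 0`; rotation invariance of the kernel and Fubini, landed `logPotential_circMean_eq_zero`). [folklore] -/
theorem evenSym_psi_circMean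
    (hcirc : ∀ r : ℝ, 0 < r → ∫ θ in (-Real.pi)..Real.pi, w (circlePt r θ) = 0) (r : ℝ) :
    ∫ θ in (-Real.pi)..Real.pi, ψ (circlePt r θ) = 0 := by
  obtain ⟨B, -, h0, -⟩ := oddSym_exists_gauss_bound_C1 (hw.of_le one_le_two) hwc
  have hcirc' : ∀ r, 0 < r →
      ∫ θ in (0:ℝ)..(2 * Real.pi), w (toLp 2 ![r * Real.cos θ, r * Real.sin θ]) = 0 := by
    intro r hr
    rw [intervalIntegral_circle_zero_two_pi_eq w r]
    exact hcirc r hr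
  have h := logPotential_circMean_eq_zero hw.continuous h0 hcirc' r
  have h2 := intervalIntegral_circle_zero_two_pi_eq
    (fun ξ => ∫ η, (2 * Real.pi)⁻¹ * Real.log ‖ξ - η‖ * w η) r
  rw [h2] at h
  have key : ∀ θ, ψ (circlePt r θ) = ∫ η, (2 * Real.pi)⁻¹ *
      Real.log ‖(toLp 2 ![r * Real.cos θ, r * Real.sin θ] : EuclideanSpace ℝ (Fin 2)) - η‖ * w η :=
    fun θ => hψ _
  simp_rw [key]
  exact h

include hw hwc hψ hu in
/-- **`u = Φ(|x|)ψ` has zero circular means when `w` has** (`Φ(|·|)` is constant on circles). [folklore] -/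
theorem evenSym_u_circMean
    (hcirc : ∀ r : ℝ, 0 < r → ∫ θ in (-Real.pi)..Real.pi, w (circlePt r θ) = 0) (r : ℝ) (_hr : 0 < r) :
    ∫ θ in (-Real.pi)..Real.pi, u (circlePt r θ) = 0 := by
  have key : ∀ θ, u (circlePt r θ) = kerWeight |r| * ψ (circlePt r θ) := fun θ => by
    rw [hu, norm_circlePt]
  simp_rw [key]
  rw [intervalIntegral.integral_const_mul, evenSym_psi_circMean hw hwc hψ hcirc r, mul_zero]

/-! ### The pointwise majorant of `|x| ‖∇u‖` -/

include hw hwc hψ hu in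
/-- **`|x| ‖Du(x)‖ ≤ |w| + c (‖Dψ‖ + |ψ|)`**, `c = 6C_Φ(1+|x|)^{N+1}e^{−|x|²/4}`: `Du = Φ Dψ + ψ DΦ(|·|)`,
the Gaussian class `(C_Φ, N)` of `Φ(|·|)` and `|x| ≤ 1 + |x|` (the term `|w|` is added only to match
the majorant of `L_λ u`). [folklore] -/
theorem evenSym_norm_mul_norm_fderiv_u_le {Cθ : ℝ} {N : ℕ}
    (hθ : ∀ x : EuclideanSpace ℝ (Fin 2),
      |kerWeight ‖x‖| ≤ Cθ * (1 + ‖x‖) ^ N * Real.exp (-(‖x‖ ^ 2 / 4)) ∧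
      ‖fderiv ℝ (fun y : EuclideanSpace ℝ (Fin 2) => kerWeight ‖y‖) x‖ ≤ Cθ * (1 + ‖x‖) ^ N * Real.exp (-(‖x‖ ^ 2 / 4)) ∧
      ‖fderiv ℝ (fderiv ℝ (fun y : EuclideanSpace ℝ (Fin 2) => kerWeight ‖y‖)) x‖ ≤
        Cθ * (1 + ‖x‖) ^ N * Real.exp (-(‖x‖ ^ 2 / 4)))
    (x : EuclideanSpace ℝ (Fin 2)) :
    |‖x‖ * ‖fderiv ℝ u x‖| ≤ |w x| +
      6 * Cθ * (1 + ‖x‖) ^ (N + 1) * Real.exp (-(‖x‖ ^ 2 / 4)) * (‖fderiv ℝ ψ x‖ + |ψ x|) := by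
  obtain ⟨h0, h1, -⟩ := hθ x
  set a : ℝ := Cθ * (1 + ‖x‖) ^ N * Real.exp (-(‖x‖ ^ 2 / 4)) with ha
  have ha0 : 0 ≤ a := (abs_nonneg _).trans h0
  have hψC2 := (oddSym_psi_contDiff_two hw hwc hψ).1
  have hθd : DifferentiableAt ℝ (fun y : EuclideanSpace ℝ (Fin 2) => kerWeight ‖y‖) x :=
    (oddSym_theta_contDiff (n := 1)).differentiable one_ne_zero x
  have hψd : DifferentiableAt ℝ ψ x := hψC2.differentiable two_ne_zero x
  have hD : fderiv ℝ u x = kerWeight ‖x‖ • fderiv ℝ ψ x +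
      ψ x • fderiv ℝ (fun y : EuclideanSpace ℝ (Fin 2) => kerWeight ‖y‖) x := by
    rw [oddSym_u_eq hu, fderiv_fun_mul hθd hψd]
  have hn : ‖fderiv ℝ u x‖ ≤ a * (‖fderiv ℝ ψ x‖ + |ψ x|) := by
    rw [hD]
    calc ‖kerWeight ‖x‖ • fderiv ℝ ψ x + ψ x • fderiv ℝ (fun y : EuclideanSpace ℝ (Fin 2) => kerWeight ‖y‖) x‖
        ≤ ‖kerWeight ‖x‖ • fderiv ℝ ψ x‖ + ‖ψ x • fderiv ℝ (fun y : EuclideanSpace ℝ (Fin 2) => kerWeight ‖y‖) x‖ :=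
          norm_add_le _ _
      _ = |kerWeight ‖x‖| * ‖fderiv ℝ ψ x‖ + |ψ x| * ‖fderiv ℝ (fun y : EuclideanSpace ℝ (Fin 2) => kerWeight ‖y‖) x‖ := by
          rw [norm_smul, norm_smul, Real.norm_eq_abs, Real.norm_eq_abs]
      _ ≤ a * ‖fderiv ℝ ψ x‖ + |ψ x| * a :=
          add_le_add (mul_le_mul_of_nonneg_right h0 (norm_nonneg _)) (mul_le_mul_of_nonneg_left h1 (abs_nonneg _))
      _ = a * (‖fderiv ℝ ψ x‖ + |ψ x|) := by ring
  have hx : ‖x‖ * a ≤ 6 * Cθ * (1 + ‖x‖) ^ (N + 1) * Real.exp (-(‖x‖ ^ 2 / 4)) := by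
    have key : 6 * Cθ * (1 + ‖x‖) ^ (N + 1) * Real.exp (-(‖x‖ ^ 2 / 4)) = 6 * (1 + ‖x‖) * a := by
      rw [pow_succ]; ring
    rw [key]
    nlinarith [norm_nonneg x]
  have hS0 : 0 ≤ ‖fderiv ℝ ψ x‖ + |ψ x| := by positivity
  rw [abs_of_nonneg (mul_nonneg (norm_nonneg _) (norm_nonneg _))]
  calc ‖x‖ * ‖fderiv ℝ u x‖ ≤ ‖x‖ * (a * (‖fderiv ℝ ψ x‖ + |ψ x|)) := mul_le_mul_of_nonneg_left hn (norm_nonneg _)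
    _ = (‖x‖ * a) * (‖fderiv ℝ ψ x‖ + |ψ x|) := by ring
    _ ≤ 6 * Cθ * (1 + ‖x‖) ^ (N + 1) * Real.exp (-(‖x‖ ^ 2 / 4)) * (‖fderiv ℝ ψ x‖ + |ψ x|) :=
        mul_le_mul_of_nonneg_right hx hS0
    _ ≤ _ := le_add_of_nonneg_left (abs_nonneg _)

end Parity

/-! ### The weighted bound for any `F` under the pointwise majorant -/

/-- **`∫ G_λ⁻¹ F² ≤ K ‖w‖²_{X_λ}` for every measurable `F` with `|F| ≤ |w| + c(‖Dψ‖ + |ψ|)`**,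
`c = 6C_Φ(1+|x|)^{N+1}e^{−|x|²/4}`, `ψ = N ∗ w`, `w ∈ C²_c`, with `K = K(λ, C_Φ, N)` (`λ ∈ (0,1)`):
`G_λ⁻¹F² ≤ 3(G_λ⁻¹w² + m‖Dψ‖² + mψ²)` with the bounded integrable weight `m = G_λ⁻¹c²`
(`oddSym_weight_props`), and tools D (`∫ mψ²`, `∫ m‖Dψ‖²` by `‖w‖₂², ‖w‖₁², (∫|y||w|)²`, all controlled by
`‖w‖²_{X_λ}`). The argument of `stub_oddSymmetrizerBounds`, isolated. [folklore] -/
theorem evenSym_weighted_sq_integral_le {lam Cθ : ℝ} (hlam : lam ∈ Set.Ioo (0 : ℝ) 1) (hCθ : 0 ≤ Cθ) (N : ℕ) :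
    ∃ K : ℝ, 0 ≤ K ∧ ∀ (w ψ F : EuclideanSpace ℝ (Fin 2) → ℝ), ContDiff ℝ 2 w → HasCompactSupport w →
    (∀ x, ψ x = ∫ y, (2 * Real.pi)⁻¹ * Real.log ‖x - y‖ * w y) → AEStronglyMeasurable F volume →
    (∀ x, |F x| ≤ |w x| + 6 * Cθ * (1 + ‖x‖) ^ (N + 1) * Real.exp (-(‖x‖ ^ 2 / 4)) * (‖fderiv ℝ ψ x‖ + |ψ x|)) →
    Integrable (fun x => (gaussWeightLam lam x)⁻¹ * F x ^ 2) ∧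
    ∫ x, (gaussWeightLam lam x)⁻¹ * F x ^ 2 ≤ K * ∫ x, (gaussWeightLam lam x)⁻¹ * w x ^ 2 := by
  have hlam' : lam ∈ Set.Ico (0 : ℝ) 1 := ⟨hlam.1.le, hlam.2⟩
  have hl1 : lam < 1 := hlam.2
  obtain ⟨CY, hCY, hY⟩ := biotSavart2D_mul_sq_integral_le
  -- the weight `m = G_λ⁻¹ c²` and the constants
  set m : EuclideanSpace ℝ (Fin 2) → ℝ := fun x => (gaussWeightLam lam x)⁻¹ *
    (6 * Cθ * (1 + ‖x‖) ^ (N + 1) * Real.exp (-(‖x‖ ^ 2 / 4))) ^ 2 with hm_def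
  obtain ⟨hm0, hmH, hmm, hmi, hmi2⟩ := oddSym_weight_props hlam' hCθ N (m := m) (fun x => rfl)
  set Hm : ℝ := (6 * Cθ * (4 * Real.pi)) ^ 2 * (1 - lam)⁻¹ *
    ((4 * Real.pi)⁻¹ * (2 ^ (2 * (N + 1)) * (2 + 8 ^ (2 * (N + 1)) * (2 * (N + 1)).factorial))) with hHm_def
  set sl : ℝ := (1 - lam) / (4 * Real.pi) with hsl_def
  set I₀ : ℝ := ∫ z, (ball (0 : EuclideanSpace ℝ (Fin 2)) 1).indicator (fun z => -Real.log ‖z‖) z with hI₀_def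
  set M₂ : ℝ := ∫ x : EuclideanSpace ℝ (Fin 2), ‖x‖ ^ 2 * gaussWeightLam lam x with hM₂_def
  set Im : ℝ := ∫ x, m x with hIm_def
  set Im2 : ℝ := ∫ x, m x * (1 + ‖x‖) ^ 2 with hIm2_def
  have hq : 0 < 1 - lam := by linarith
  have hHm0 : 0 ≤ Hm := by positivity
  have hsl0 : 0 ≤ sl := by positivity
  have hIm0 : 0 ≤ Im := integral_nonneg hm0
  have hIm20 : 0 ≤ Im2 := integral_nonneg fun x => mul_nonneg (hm0 x) (sq_nonneg _)
  have hM₂0 : 0 ≤ M₂ := integral_nonneg fun x => mul_nonneg (sq_nonneg _) (gaussWeightLam_pos hl1 x).le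
  set K : ℝ := 3 * (1 + CY * (Hm * sl + Im) + 3 * (2 * Real.pi)⁻¹ ^ 2 * (I₀ ^ 2 * Hm * sl + Im2 + M₂ * Im)) with hK_def
  have hK0 : 0 ≤ K := by positivity
  refine ⟨K, hK0, ?_⟩
  intro w ψ F hw hwc hψ hFm hF
  obtain ⟨Cw, Nw, -, hwC⟩ := oddSym_class_of_hasCompactSupport hw hwc
  have hIw : Integrable (fun x => (gaussWeightLam lam x)⁻¹ * w x ^ 2) :=
    oddSym_integrable_inv_gaussWeightLam_mul_sq hlam' hw.continuous.aestronglyMeasurable fun x => (hwC x).1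
  set S : ℝ := ∫ x, (gaussWeightLam lam x)⁻¹ * w x ^ 2 with hS_def
  have hψC2 := (oddSym_psi_contDiff_two hw hwc hψ).1
  obtain ⟨hIψ, hψle⟩ := oddSym_integral_weight_mul_psi_sq_le hmm hm0 hmH hmi hmi2 hw.continuous hwc
    hψC2.continuous hψ
  obtain ⟨hIDψ, hDψle⟩ := oddSym_integral_weight_mul_norm_fderiv_psi_sq_le hmm hm0 hmH hmi hY hw hwc hψ
  have hn1 := oddSym_sq_integral_abs_le hl1 hw.continuous hIw
  have hm1 := oddSym_sq_integral_norm_mul_abs_le hl1 hw.continuous hIw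
  have hwc2 : HasCompactSupport (fun y => w y ^ 2) := hwc.mono fun y hy => by simpa using hy
  have hw2i : Integrable fun y => w y ^ 2 := (hw.continuous.pow 2).integrable_of_hasCompactSupport hwc2
  have hw2 := oddSym_integral_sq_le hl1 hw2i hIw
  -- pointwise majorant `G_λ⁻¹ F² ≤ 3 (G_λ⁻¹ w² + m |Dψ|² + m ψ²)`
  have hpt : ∀ x, (gaussWeightLam lam x)⁻¹ * F x ^ 2 ≤
      3 * ((gaussWeightLam lam x)⁻¹ * w x ^ 2 + m x * ‖fderiv ℝ ψ x‖ ^ 2 + m x * ψ x ^ 2) := fun x => by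
    have hg0 : 0 ≤ (gaussWeightLam lam x)⁻¹ := (inv_pos.2 (gaussWeightLam_pos hl1 x)).le
    have hc0 : 0 ≤ 6 * Cθ * (1 + ‖x‖) ^ (N + 1) * Real.exp (-(‖x‖ ^ 2 / 4)) := by positivity
    have h := oddSym_sq_le_of_abs_le hc0 (norm_nonneg (fderiv ℝ ψ x)) (hF x)
    calc (gaussWeightLam lam x)⁻¹ * F x ^ 2
        ≤ (gaussWeightLam lam x)⁻¹ * (3 * (w x ^ 2 +
            (6 * Cθ * (1 + ‖x‖) ^ (N + 1) * Real.exp (-(‖x‖ ^ 2 / 4))) ^ 2 * ‖fderiv ℝ ψ x‖ ^ 2 +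
            (6 * Cθ * (1 + ‖x‖) ^ (N + 1) * Real.exp (-(‖x‖ ^ 2 / 4))) ^ 2 * ψ x ^ 2)) :=
          mul_le_mul_of_nonneg_left h hg0
      _ = _ := by simp only [hm_def]; ring
  have hF1 : Integrable fun x => (gaussWeightLam lam x)⁻¹ * w x ^ 2 + m x * ‖fderiv ℝ ψ x‖ ^ 2 := hIw.add hIDψ
  have hF12 : Integrable fun x => (gaussWeightLam lam x)⁻¹ * w x ^ 2 + m x * ‖fderiv ℝ ψ x‖ ^ 2 + m x * ψ x ^ 2 :=
    hF1.add hIψ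
  have hFi : Integrable fun x => 3 * ((gaussWeightLam lam x)⁻¹ * w x ^ 2 + m x * ‖fderiv ℝ ψ x‖ ^ 2 + m x * ψ x ^ 2) :=
    hF12.const_mul 3
  have hIF : Integrable (fun x => (gaussWeightLam lam x)⁻¹ * F x ^ 2) :=
    hFi.mono' ((continuous_inv_gaussWeightLam hl1).aestronglyMeasurable.mul (hFm.pow 2))
      (Eventually.of_forall fun x => by
        rw [Real.norm_of_nonneg (mul_nonneg (inv_pos.2 (gaussWeightLam_pos hl1 x)).le (sq_nonneg _))]
        exact hpt x)
  refine ⟨hIF, ?_⟩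
  have hc' : (0:ℝ) ≤ 3 * (2 * Real.pi)⁻¹ ^ 2 := by positivity
  calc ∫ x, (gaussWeightLam lam x)⁻¹ * F x ^ 2
      ≤ ∫ x, 3 * ((gaussWeightLam lam x)⁻¹ * w x ^ 2 + m x * ‖fderiv ℝ ψ x‖ ^ 2 + m x * ψ x ^ 2) :=
        integral_mono hIF hFi hpt
    _ = 3 * (S + (∫ x, m x * ‖fderiv ℝ ψ x‖ ^ 2) + ∫ x, m x * ψ x ^ 2) := by
        rw [integral_const_mul, integral_add hF1 hIψ, integral_add hIw hIDψ]
    _ ≤ 3 * (S + CY * (Hm * (∫ y, w y ^ 2) + (∫ y, |w y|) ^ 2 * Im) +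
        3 * (2 * Real.pi)⁻¹ ^ 2 * (I₀ ^ 2 * Hm * (∫ y, w y ^ 2) + (∫ y, |w y|) ^ 2 * Im2 + (∫ y, ‖y‖ * |w y|) ^ 2 * Im)) := by
        linarith [hDψle, hψle]
    _ ≤ 3 * (S + CY * (Hm * (sl * S) + S * Im) +
        3 * (2 * Real.pi)⁻¹ ^ 2 * (I₀ ^ 2 * Hm * (sl * S) + S * Im2 + (M₂ * S) * Im)) := by
        have a1 : Hm * (∫ y, w y ^ 2) ≤ Hm * (sl * S) := mul_le_mul_of_nonneg_left hw2 hHm0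
        have a2 : (∫ y, |w y|) ^ 2 * Im ≤ S * Im := mul_le_mul_of_nonneg_right hn1 hIm0
        have a3 : I₀ ^ 2 * Hm * (∫ y, w y ^ 2) ≤ I₀ ^ 2 * Hm * (sl * S) :=
          mul_le_mul_of_nonneg_left hw2 (mul_nonneg (sq_nonneg _) hHm0)
        have a4 : (∫ y, |w y|) ^ 2 * Im2 ≤ S * Im2 := mul_le_mul_of_nonneg_right hn1 hIm20
        have a5 : (∫ y, ‖y‖ * |w y|) ^ 2 * Im ≤ (M₂ * S) * Im := mul_le_mul_of_nonneg_right hm1 hIm0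
        have b1 : CY * (Hm * (∫ y, w y ^ 2) + (∫ y, |w y|) ^ 2 * Im) ≤ CY * (Hm * (sl * S) + S * Im) :=
          mul_le_mul_of_nonneg_left (add_le_add a1 a2) hCY.le
        have b2 : 3 * (2 * Real.pi)⁻¹ ^ 2 * (I₀ ^ 2 * Hm * (∫ y, w y ^ 2) + (∫ y, |w y|) ^ 2 * Im2 + (∫ y, ‖y‖ * |w y|) ^ 2 * Im) ≤
            3 * (2 * Real.pi)⁻¹ ^ 2 * (I₀ ^ 2 * Hm * (sl * S) + S * Im2 + (M₂ * S) * Im) :=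
          mul_le_mul_of_nonneg_left (add_le_add (add_le_add a3 a4) a5) hc'
        linarith
    _ = K * S := by simp only [hK_def]; ring

/-! ### The registered stub -/

/-- **Stub (B1) of crux stmt-NavierStokesRegularity-17973, line `Sketch` (forward symmetrizer on the even
circular-mean-free sector).** For `λ ∈ (0,1)` there is `C ≥ 0` such that for every EVEN `C²_c` vorticity
`w` with zero circular means, with `ψ = N∗w` and `u = Φ(|x|)ψ` (`Φ = kerWeight`): `u ∈ C²` is even with
zero circular means, `w + u` is of second-order Gaussian class, `T_{λ,R} w = H_{λ,R}(w+u) − L_λ u`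
pointwise for every `R`, all the weighted squares met are integrable, `L_λ u` and `H(w+u)` are
continuous, `‖L_λ u‖_{X_λ} ≤ C ‖w‖_{X_λ}` and `‖ |x| ∇u ‖_{X_λ} ≤ C ‖w‖_{X_λ}`. [folklore] -/
theorem stub_evenSymmetrizerBounds :
    ∀ lam ∈ Set.Ioo (0 : ℝ) 1, ∃ C : ℝ, 0 ≤ C ∧
    ∀ (w ψ u : EuclideanSpace ℝ (Fin 2) → ℝ), ContDiff ℝ 2 w → HasCompactSupport w →
    (∀ x, w (-x) = w x) →
    (∀ r : ℝ, 0 < r → ∫ θ in (-Real.pi)..Real.pi, w (circlePt r θ) = 0) →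
    (∀ x, ψ x = ∫ y, (2 * Real.pi)⁻¹ * Real.log ‖x - y‖ * w y) →
    (∀ x, u x = kerWeight ‖x‖ * ψ x) →
    ContDiff ℝ 2 u ∧ (∀ x, u (-x) = u x) ∧
    (∀ r : ℝ, 0 < r → ∫ θ in (-Real.pi)..Real.pi, u (circlePt r θ) = 0) ∧
    (∃ (C' : ℝ) (N : ℕ), ∀ x : EuclideanSpace ℝ (Fin 2),
      |w x + u x| ≤ C' * (1 + ‖x‖) ^ N * Real.exp (-(‖x‖ ^ 2 / 4)) ∧
      ‖fderiv ℝ (fun y => w y + u y) x‖ ≤ C' * (1 + ‖x‖) ^ N * Real.exp (-(‖x‖ ^ 2 / 4)) ∧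
      ‖fderiv ℝ (fderiv ℝ (fun y => w y + u y)) x‖ ≤ C' * (1 + ‖x‖) ^ N * Real.exp (-(‖x‖ ^ 2 / 4))) ∧
    (∀ (R : ℝ) (x : EuclideanSpace ℝ (Fin 2)),
      strainedVorticityOperator lam w x -
          R * (⟪gaussVortexVelocity x, gradient w x⟫_ℝ +
            ⟪biotSavart2D w x, gradient gaussVortexProfile x⟫_ℝ) =
        (strainedVorticityOperator lam (fun y => w y + u y) x -
            R * ⟪gaussVortexVelocity x, gradient (fun y => w y + u y) x⟫_ℝ) -
          strainedVorticityOperator lam u x) ∧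
    Integrable (fun x => (gaussWeightLam lam x)⁻¹ * w x ^ 2) ∧
    (∀ R : ℝ, Integrable (fun x => (gaussWeightLam lam x)⁻¹ * (strainedVorticityOperator lam w x -
      R * (⟪gaussVortexVelocity x, gradient w x⟫_ℝ +
        ⟪biotSavart2D w x, gradient gaussVortexProfile x⟫_ℝ)) ^ 2)) ∧
    Integrable (fun x => (gaussWeightLam lam x)⁻¹ * (w x + u x) ^ 2) ∧
    Integrable (fun x => (gaussWeightLam lam x)⁻¹ * (strainedVorticityOperator lam u x) ^ 2) ∧
    (∀ R : ℝ, Integrable (fun x => (gaussWeightLam lam x)⁻¹ *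
      (strainedVorticityOperator lam (fun y => w y + u y) x -
        R * ⟪gaussVortexVelocity x, gradient (fun y => w y + u y) x⟫_ℝ) ^ 2)) ∧
    Continuous (fun x => strainedVorticityOperator lam u x) ∧
    (∀ R : ℝ, Continuous (fun x => strainedVorticityOperator lam (fun y => w y + u y) x -
        R * ⟪gaussVortexVelocity x, gradient (fun y => w y + u y) x⟫_ℝ)) ∧
    ∫ x, (gaussWeightLam lam x)⁻¹ * (strainedVorticityOperator lam u x) ^ 2 ≤
      C ^ 2 * ∫ x, (gaussWeightLam lam x)⁻¹ * w x ^ 2 ∧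
    Integrable (fun x => (gaussWeightLam lam x)⁻¹ * (‖x‖ ^ 2 * ‖fderiv ℝ u x‖ ^ 2)) ∧
    ∫ x, (gaussWeightLam lam x)⁻¹ * (‖x‖ ^ 2 * ‖fderiv ℝ u x‖ ^ 2) ≤
      C ^ 2 * ∫ x, (gaussWeightLam lam x)⁻¹ * w x ^ 2 := by
  intro lam hlam
  have hlam' : lam ∈ Set.Ico (0 : ℝ) 1 := ⟨hlam.1.le, hlam.2⟩
  have hl : |lam| ≤ 1 := by rw [abs_le]; constructor <;> linarith [hlam.1, hlam.2]
  obtain ⟨Cθ, N, hCθ, hθ⟩ := oddSym_theta_bounds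
  obtain ⟨K, hK0, hK⟩ := evenSym_weighted_sq_integral_le hlam hCθ N
  refine ⟨Real.sqrt K, Real.sqrt_nonneg K, ?_⟩
  intro w ψ u hw hwc heven hcirc hψ hu
  obtain ⟨huC2, -, hclass, hident, hrest⟩ := stub_oddSymmetrizerBoundsToolsC w ψ u hw hwc hψ hu
  obtain ⟨hIw, hIwu, hILu, hIH, hcL, hcH⟩ := hrest lam hlam
  obtain ⟨C', N', -, hclass'⟩ := hclass
  have hKs : Real.sqrt K ^ 2 = K := Real.sq_sqrt hK0
  -- `‖L_λ u‖ ≤ C ‖w‖`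
  obtain ⟨-, hLu⟩ := hK w ψ (fun x => strainedVorticityOperator lam u x) hw hwc hψ hcL.aestronglyMeasurable
    fun x => oddSym_abs_L_u_le hw hwc hψ hu hl hθ x
  -- `‖ |x| ∇u ‖ ≤ C ‖w‖`
  have hgm : AEStronglyMeasurable (fun x : EuclideanSpace ℝ (Fin 2) => ‖x‖ * ‖fderiv ℝ u x‖) volume :=
    (continuous_norm.mul (huC2.continuous_fderiv two_ne_zero).norm).aestronglyMeasurable
  obtain ⟨hIg, hg⟩ := hK w ψ (fun x => ‖x‖ * ‖fderiv ℝ u x‖) hw hwc hψ hgm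
    fun x => evenSym_norm_mul_norm_fderiv_u_le hw hwc hψ hu hθ x
  have heq : ∀ x : EuclideanSpace ℝ (Fin 2), (gaussWeightLam lam x)⁻¹ * (‖x‖ ^ 2 * ‖fderiv ℝ u x‖ ^ 2) =
      (gaussWeightLam lam x)⁻¹ * (‖x‖ * ‖fderiv ℝ u x‖) ^ 2 := fun x => by rw [mul_pow]
  have hIg' : Integrable (fun x => (gaussWeightLam lam x)⁻¹ * (‖x‖ ^ 2 * ‖fderiv ℝ u x‖ ^ 2)) :=
    hIg.congr (Eventually.of_forall fun x => (heq x).symm)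
  have hg' : ∫ x, (gaussWeightLam lam x)⁻¹ * (‖x‖ ^ 2 * ‖fderiv ℝ u x‖ ^ 2) =
      ∫ x, (gaussWeightLam lam x)⁻¹ * (‖x‖ * ‖fderiv ℝ u x‖) ^ 2 :=
    integral_congr_ae (Eventually.of_forall heq)
  refine ⟨huC2, evenSym_u_even hψ hu heven, evenSym_u_circMean hw hwc hψ hu hcirc, ⟨C', N', hclass'⟩,
    hident lam, hIw, fun R => parity_integrable_weight_mul_coreOp_sq hlam' R hw hwc, hIwu, hILu, hIH, hcL,
    hcH, ?_, hIg', ?_⟩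
  · rw [hKs]; exact hLu
  · rw [hKs, hg']; exact hg

end Summit.NavierStokesRegularity.NavierStokesRegularity.Theorems
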